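import Literature.NumberTheory.LFunctions.ConreyIwaniec2002MeanValues
import Literature.NumberTheory.LFunctions.ConreyIwaniec2002SpacingMechanism
import Literature.Analysis.SpecialFunctions.DigammaVerticalAsymptotics
import Mathlib.Analysis.SpecialFunctions.Gamma.Digamma
import Mathlib.Analysis.SpecialFunctions.Gamma.Deriv
import Mathlib.Analysis.SpecialFunctions.Pow.Deriv
import Mathlib.Analysis.Calculus.MeanValue
import Mathlib.Analysis.SpecialFunctions.Trigonometric.Bounds
import Mathlib.Analysis.Complex.Trigonometric
import HarnessLib

/-!
# Conrey–Iwaniec (2002), Lemma 7.5 in the inequality form (9.10): the root-number quotient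
# `x(s)` dominates `2|sin((t−t′)log t)/(t−t′)|` up to `O(log q)`

Conrey–Iwaniec, *Spacing of zeros of Hecke L-functions and the class number problem*, Acta Arith.
103 (2002), §7 (7.26)–(7.28) and §9 (9.10) [held text `paper:arxiv-math_0111012`, p0018:L83–100,
p0020:L64–71]. With `X(s) = Q^{1−2s}Γ(1−s)/Γ(s)` (7.13), `Q = √q/2π`, and
`x(s) = (X(s) − X(s′))/(s − s′)` (7.20) (`X′(s)` at `s′ = s`), Lemma 7.5 states
`|x(s)| = 2|sin((t−t′)log tQ)/(t−t′)| + O(1/t)` for `s = ½ + it`, `s′ = ½ + it′`, `t, t′ ≥ 1`, and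
§9 uses it in the form (9.10): `|x(s)| = 2|sin((t−t′)log t)/(t−t′)| + O(log q)`.

PROVED HERE (no named fact), in the one-sided form consumed by the derivation of the principal
estimate (9.12) (`ConreyIwaniec2002.two_mul_log_mul_sincTerm_le`): for `q > 4`, `t ≥ 2` and EVERY
real `t′`,
`2 log t · |sin((t−t′)log t)/((t−t′)log t)| ≤ |x(s)| + C log q`
with an absolute `C`. Ingredients: the derivative of `X` (`hasDerivAt_afeX`:
`X′(s) = X(s)(−2 log Q − ψ(1−s) − ψ(s))`), `|X(½+it)| = 1` (tree, `norm_afeX_half`), the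
vertical Stirling asymptotics `ψ(½ + iy) = log(1+|y|) + O(1)` (tree,
`exists_norm_digamma_sub_log_le_of_pos`), and a demodulation argument: for `|t − t′| < 1` the
function `Z(v) = X(½+iv)e^{−ic(v−t′)}`, `c = −2(log Q + log t)`, has `|Z′| = |ψ(½−iv) + ψ(½+iv) − 2log t| ≪ 1`,
so `|X(s) − X(s′)| ≥ |e^{ic(t−t′)} − 1| − O(|t−t′|) = 2|sin((t−t′)log tQ)| − O(|t−t′|)`; the cases
`|t − t′| ≥ 1` (trivial) and `t′ = t` (`|X′(s)| ≥ 2 log t − O(log q)`) are separate.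

## References

* [ConreyIwaniec2002] B. Conrey, H. Iwaniec, Acta Arith. 103 (2002) 259–312, arXiv:math/0111012:
  §7 (7.13), (7.20), (7.26)–(7.28) (Lemma 7.5); §9 (9.10).
-/

noncomputable section

open Complex

namespace Literature.NumberTheory.LFunctions

namespace ConreyIwaniec2002

open Literature.Analysis.SpecialFunctions.Complex in
/-- Vertical Stirling for `ψ` on the critical line, two-sided in `y` and with a non-negative
constant: `‖ψ(½ + iy) − log(1 + |y|)‖ ≤ C` for every real `y`.
[cite: ConreyIwaniec2002, Lemma 7.5 (7.27)] -/
theorem exists_norm_digamma_half_line_sub_log_le :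
    ∃ C : ℝ, 0 ≤ C ∧ ∀ y : ℝ, ‖digamma (1 / 2 + y * I) - Real.log (1 + |y|)‖ ≤ C := by
  obtain ⟨C, hC⟩ := exists_norm_digamma_sub_log_le_of_pos (a := 1 / 2) (by norm_num)
  refine ⟨max C 0, le_max_right _ _, fun y => ?_⟩
  have h := hC y
  push_cast at h
  exact h.trans (le_max_left _ _)

/-- A point of the open right half-plane is not a pole of `Γ`. [folklore] -/
private theorem ne_neg_nat_of_re_pos {z : ℂ} (hz : 0 < z.re) (m : ℕ) : z ≠ -(m : ℂ) := by
  intro h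
  have : z.re = -(m : ℝ) := by rw [h]; simp
  linarith [(Nat.cast_nonneg m : (0 : ℝ) ≤ m)]

/-- `Γ′(z) = ψ(z)Γ(z)` in the right half-plane. [folklore] -/
private theorem deriv_Gamma_eq_digamma_mul {z : ℂ} (hz : 0 < z.re) :
    deriv Gamma z = digamma z * Gamma z := by
  rw [digamma_def, logDeriv_apply, div_mul_cancel₀ _ (Gamma_ne_zero_of_re_pos hz)]

/-- **The derivative of the root-number factor**: `X′(s) = X(s)(−2 log Q − ψ(1−s) − ψ(s))` for
`0 < Re s < 1` (`X(s) = Q^{1−2s}Γ(1−s)/Γ(s)`, so `X′/X = −2 log Q − Γ′/Γ(1−s) − Γ′/Γ(s)`; this is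
(7.27) differentiated). [cite: ConreyIwaniec2002, Lemma 7.5 (7.26)–(7.27)] -/
theorem hasDerivAt_afeX {q : ℕ} (hq : 0 < q) {s : ℂ} (h0 : 0 < s.re) (h1 : s.re < 1) :
    HasDerivAt (afeX q)
      (afeX q s * (-(2 * (Real.log (condQ q) : ℂ)) - digamma (1 - s) - digamma s)) s := by
  have hQ : 0 < condQ q := condQ_pos hq
  have hQ' : (condQ q : ℂ) ≠ 0 := by exact_mod_cast hQ.ne'
  have hΓs : Gamma s ≠ 0 := Gamma_ne_zero_of_re_pos h0
  have h1s : 0 < (1 - s).re := by simp; linarith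
  have hΓ1s : Gamma (1 - s) ≠ 0 := Gamma_ne_zero_of_re_pos h1s
  -- the three factors
  have hA : HasDerivAt (fun z : ℂ => (condQ q : ℂ) ^ (1 - 2 * z))
      ((condQ q : ℂ) ^ (1 - 2 * s) * Complex.log (condQ q) * (-2)) s := by
    have h : HasDerivAt (fun z : ℂ => 1 - 2 * z) (-2) s := by
      simpa using ((hasDerivAt_id s).const_mul (2 : ℂ)).const_sub 1
    exact h.const_cpow (Or.inl hQ')
  have hB : HasDerivAt (fun z : ℂ => Gamma (1 - z)) (-(digamma (1 - s) * Gamma (1 - s))) s := by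
    have hd : HasDerivAt Gamma (deriv Gamma (1 - s)) (1 - s) :=
      (differentiableAt_Gamma _ (ne_neg_nat_of_re_pos h1s)).hasDerivAt
    have h : HasDerivAt (fun z : ℂ => 1 - z) (-1) s := by
      simpa using (hasDerivAt_id s).const_sub 1
    have h2 : HasDerivAt (fun z : ℂ => Gamma (1 - z)) (deriv Gamma (1 - s) * (-1)) s := hd.comp s h
    rw [deriv_Gamma_eq_digamma_mul h1s] at h2
    exact h2.congr_deriv (by ring)
  have hC : HasDerivAt Gamma (digamma s * Gamma s) s := by
    have := (differentiableAt_Gamma _ (ne_neg_nat_of_re_pos h0)).hasDerivAt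
    rwa [deriv_Gamma_eq_digamma_mul h0] at this
  have hprod := (hA.mul hB).div hC hΓs
  have hfun : ((fun z : ℂ => (condQ q : ℂ) ^ (1 - 2 * z)) * fun z : ℂ => Gamma (1 - z)) / Gamma =
      afeX q := by
    funext z; simp only [Pi.div_apply, Pi.mul_apply, afeX]
  rw [hfun] at hprod
  refine hprod.congr_deriv ?_
  simp only [Pi.mul_apply, afeX]
  rw [← Complex.ofReal_log hQ.le]
  field_simp
  ring

/-- The derivative of `v ↦ X(½ + iv)` along the critical line: `i X(s)(−2 log Q − ψ(1−s) − ψ(s))`.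
[cite: ConreyIwaniec2002, Lemma 7.5 (7.26)–(7.27)] -/
theorem hasDerivAt_afeX_line {q : ℕ} (hq : 0 < q) (u : ℝ) :
    HasDerivAt (fun v : ℝ => afeX q (1 / 2 + v * I))
      (afeX q (1 / 2 + u * I) *
        (-(2 * (Real.log (condQ q) : ℂ)) - digamma (1 - (1 / 2 + u * I)) - digamma (1 / 2 + u * I)) *
        I) u := by
  have hs0 : 0 < ((1 / 2 : ℂ) + (u : ℂ) * I).re := by simp
  have hs1 : ((1 / 2 : ℂ) + (u : ℂ) * I).re < 1 := by norm_num
  have hpath : HasDerivAt (fun v : ℝ => (1 / 2 : ℂ) + v * I) I u := by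
    have h1 : HasDerivAt (fun v : ℝ => (v : ℂ) * I) (1 * I) u :=
      (hasDerivAt_id u).ofReal_comp.mul_const I
    simpa using h1.const_add (1 / 2 : ℂ)
  exact (hasDerivAt_afeX hq hs0 hs1).comp u hpath

/-- `|log Q| ≤ ½ log q + 2` for `Q = √q/2π`, `q ≥ 1`. [cite: ConreyIwaniec2002, §7 (7.6)] -/
theorem abs_log_condQ_le {q : ℕ} (hq : 0 < q) :
    |Real.log (condQ q)| ≤ Real.log q / 2 + 2 := by
  have hq1 : (1 : ℝ) ≤ q := by exact_mod_cast hq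
  have hpi := Real.pi_pos
  have hpi3 := Real.pi_gt_three
  have hpi4 := Real.pi_lt_four
  unfold condQ
  rw [Real.log_div (Real.sqrt_pos.mpr (by linarith)).ne' (by positivity), Real.log_sqrt (by linarith)]
  -- `0 ≤ log (2π) ≤ 2`
  have h2pi0 : 0 ≤ Real.log (2 * Real.pi) := Real.log_nonneg (by linarith)
  have h2pi2 : Real.log (2 * Real.pi) ≤ 2 := by
    rw [Real.log_le_iff_le_exp (by positivity)]
    have he := Real.exp_one_gt_d9
    have hpi' := Real.pi_lt_d2
    have h2 : Real.exp 2 = Real.exp 1 * Real.exp 1 := by rw [← Real.exp_add]; norm_num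
    have h3 : (2.7182818283 : ℝ) * 2.7182818283 < Real.exp 1 * Real.exp 1 :=
      mul_lt_mul'' he he (by norm_num) (by norm_num)
    rw [h2]
    linarith
  have hlog0 : 0 ≤ Real.log q := Real.log_nonneg hq1
  rw [abs_le]
  constructor <;> linarith

/-- `ψ(½ ± iv)` is within `O(1)` of `log t` when `v` is within `1` of `t ≥ 2`: from the vertical
Stirling bound and `|log(1 + |v|) − log t| ≤ 1`. [cite: ConreyIwaniec2002, Lemma 7.5 (7.27)] -/
theorem norm_digamma_sub_log_le_of_near {C : ℝ}
    (hC : ∀ y : ℝ, ‖digamma (1 / 2 + y * I) - Real.log (1 + |y|)‖ ≤ C)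
    {t v : ℝ} (ht : 2 ≤ t) (hv : |v - t| < 1) (y : ℝ) (hy : |y| = v) :
    ‖digamma (1 / 2 + y * I) - Real.log t‖ ≤ C + 1 := by
  have hv1 : t - 1 < v ∧ v < t + 1 := by
    constructor <;> [linarith [neg_abs_le (v - t)]; linarith [le_abs_self (v - t)]]
  have hv0 : 0 < v := by linarith
  have ht0 : 0 < t := by linarith
  -- `0 ≤ log(1+v) − log t ≤ log 2 ≤ 1`
  have hlog : |Real.log (1 + |y|) - Real.log t| ≤ 1 := by
    rw [hy, ← Real.log_div (by linarith) ht0.ne']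
    have h1 : 1 ≤ (1 + v) / t := by rw [le_div_iff₀ ht0]; linarith
    have h2 : (1 + v) / t ≤ 2 := by rw [div_le_iff₀ ht0]; linarith
    rw [abs_of_nonneg (Real.log_nonneg h1)]
    calc Real.log ((1 + v) / t) ≤ Real.log 2 := Real.log_le_log (by positivity) h2
      _ ≤ 1 := by linarith [Real.log_two_lt_d9]
  have hcast : ‖((Real.log (1 + |y|) : ℝ) : ℂ) - ((Real.log t : ℝ) : ℂ)‖ ≤ 1 := by
    rw [← Complex.ofReal_sub, Complex.norm_real, Real.norm_eq_abs]; exact hlog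
  calc ‖digamma (1 / 2 + y * I) - Real.log t‖
      = ‖(digamma (1 / 2 + y * I) - Real.log (1 + |y|)) + ((Real.log (1 + |y|) : ℂ) - Real.log t)‖ := by
        ring_nf
    _ ≤ ‖digamma (1 / 2 + y * I) - Real.log (1 + |y|)‖ + ‖((Real.log (1 + |y|) : ℝ) : ℂ) - Real.log t‖ :=
        norm_add_le _ _
    _ ≤ C + 1 := add_le_add (hC y) hcast

/-- **Lemma 7.5 in the inequality form (9.10).** For `q > 4`, `t ≥ 2` and every real `t′`:
`2 log t · |sin((t−t′)log t)/((t−t′)log t)| ≤ |x(s)| + C log q`, `s = ½ + it`, `s′ = ½ + it′`,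
`x(s) = (X(s) − X(s′))/(s − s′)` (`X′(s)` at `s′ = s`), with an absolute constant `C`.
[cite: ConreyIwaniec2002, Lemma 7.5 (7.28) and §9 (9.10)] -/
theorem two_mul_log_mul_sincTerm_le :
    ∃ C : ℝ, 0 < C ∧ ∀ q : ℕ, 4 < q → ∀ t t' : ℝ, 2 ≤ t →
      2 * Real.log t * sincTerm t t' ≤
        ‖xQuot q (1 / 2 + t * I) (1 / 2 + t' * I)‖ + C * Real.log q := by
  obtain ⟨C₀, hC₀0, hC₀⟩ := exists_norm_digamma_half_line_sub_log_le
  refine ⟨9 + 2 * C₀, by positivity, fun q hq t t' ht => ?_⟩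
  have hq0 : 0 < q := by omega
  have hq5 : (5 : ℝ) ≤ q := by exact_mod_cast hq
  have hℓ1 : 1 ≤ Real.log q := by
    rw [Real.le_log_iff_exp_le (by linarith)]
    exact Real.exp_one_lt_d9.le.trans (by linarith)
  set ℓ : ℝ := Real.log q with hℓdef
  have ht0 : 0 < t := by linarith
  have hlogt : 0 < Real.log t := Real.log_pos (by linarith)
  have hQ := abs_log_condQ_le hq0
  set LQ : ℝ := Real.log (condQ q) with hLQdef
  have hxnn : 0 ≤ ‖xQuot q (1 / 2 + t * I) (1 / 2 + t' * I)‖ := norm_nonneg _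
  -- the additive junk is `≤ C log q`
  have hjunk : 2 * |LQ| + (2 * (C₀ + 1)) + 2 ≤ (9 + 2 * C₀) * ℓ := by
    have : 2 * |LQ| ≤ ℓ + 4 := by linarith
    nlinarith
  -- Case 1: far companions, `1 ≤ |t − t′|`
  by_cases hfar : 1 ≤ |t - t'|
  · have hne : t - t' ≠ 0 := fun h => by rw [h, abs_zero] at hfar; linarith
    have hx : (t - t') * Real.log t ≠ 0 := mul_ne_zero hne hlogt.ne'
    have h1 : 2 * Real.log t * sincTerm t t' ≤ 2 := by
      unfold sincTerm
      rw [Real.sinc_of_ne_zero hx, abs_div, abs_mul, abs_of_pos hlogt]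
      rw [show 2 * Real.log t * (|Real.sin ((t - t') * Real.log t)| / (|t - t'| * Real.log t)) =
        2 * (|Real.sin ((t - t') * Real.log t)| / |t - t'|) by field_simp]
      have hs : |Real.sin ((t - t') * Real.log t)| ≤ 1 := Real.abs_sin_le_one _
      have : |Real.sin ((t - t') * Real.log t)| / |t - t'| ≤ 1 := by
        rw [div_le_one (by positivity)]; linarith
      linarith
    nlinarith [abs_nonneg LQ]
  push Not at hfar
  -- Case 2: coincident companions
  by_cases heq : t' = t
  · rw [heq]
    have hs0 : 0 < ((1 / 2 : ℂ) + (t : ℂ) * I).re := by simp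
    have hs1 : ((1 / 2 : ℂ) + (t : ℂ) * I).re < 1 := by norm_num
    have hder := (hasDerivAt_afeX hq0 hs0 hs1).deriv
    rw [sincTerm_self, mul_one, xQuot_self, hder, norm_mul, norm_afeX_half q hq0, one_mul]
    have h1s : (1 : ℂ) - (1 / 2 + (t : ℂ) * I) = 1 / 2 + ((-t : ℝ) : ℂ) * I := by
      push_cast; ring
    have hψ1 := norm_digamma_sub_log_le_of_near hC₀ ht (v := t) (by simp) (-t)
      (by rw [abs_neg, abs_of_pos ht0])
    have hψ2 := norm_digamma_sub_log_le_of_near hC₀ ht (v := t) (by simp) t (abs_of_pos ht0)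
    have hdecomp : -(2 * (LQ : ℂ)) - digamma (1 - (1 / 2 + (t : ℂ) * I)) -
        digamma (1 / 2 + (t : ℂ) * I) =
        ((-(2 * LQ + 2 * Real.log t) : ℝ) : ℂ) -
          ((digamma (1 / 2 + ((-t : ℝ) : ℂ) * I) - Real.log t) +
            (digamma (1 / 2 + (t : ℂ) * I) - Real.log t)) := by
      rw [h1s]; push_cast; ring
    have hA : 2 * Real.log t - 2 * |LQ| ≤ ‖((-(2 * LQ + 2 * Real.log t) : ℝ) : ℂ)‖ := by
      rw [Complex.norm_real, Real.norm_eq_abs, abs_neg]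
      have h1 : -|LQ| ≤ LQ := neg_abs_le LQ
      have h2 : 2 * LQ + 2 * Real.log t ≤ |2 * LQ + 2 * Real.log t| := le_abs_self _
      linarith
    have hB : ‖(digamma (1 / 2 + ((-t : ℝ) : ℂ) * I) - Real.log t) +
        (digamma (1 / 2 + (t : ℂ) * I) - Real.log t)‖ ≤ 2 * (C₀ + 1) :=
      (norm_add_le _ _).trans (by linarith)
    have hmain : 2 * Real.log t - 2 * |LQ| - 2 * (C₀ + 1) ≤
        ‖-(2 * (LQ : ℂ)) - digamma (1 - (1 / 2 + (t : ℂ) * I)) - digamma (1 / 2 + (t : ℂ) * I)‖ := by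
      rw [hdecomp]
      refine le_trans ?_ (norm_sub_norm_le _ _)
      linarith
    linarith
  -- Case 3: close distinct companions, `0 < |t − t′| < 1`
  have hne : t - t' ≠ 0 := sub_ne_zero.mpr (Ne.symm heq)
  have habs0 : 0 < |t - t'| := abs_pos.mpr hne
  have hss' : (1 / 2 + (t' : ℂ) * I) ≠ 1 / 2 + (t : ℂ) * I := by
    intro h
    have := congrArg Complex.im h
    simp at this
    exact heq this
  have hnorm_ss' : ‖(1 / 2 + (t : ℂ) * I) - (1 / 2 + (t' : ℂ) * I)‖ = |t - t'| := by
    rw [show (1 / 2 + (t : ℂ) * I) - (1 / 2 + (t' : ℂ) * I) = ((t - t' : ℝ) : ℂ) * I by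
      push_cast; ring]
    rw [norm_mul, Complex.norm_I, mul_one, Complex.norm_real, Real.norm_eq_abs]
  rw [xQuot_of_ne q hss', norm_div, hnorm_ss']
  -- the main frequency and the demodulated function `Z(v) = X(½+iv) e^{-ic(v−t′)}`
  set c : ℝ := -2 * (LQ + Real.log t) with hcdef
  have hZ : ∀ v : ℝ, HasDerivAt
      (fun v : ℝ => afeX q (1 / 2 + v * I) * Complex.exp (((-(c * (v - t'))) : ℝ) * I))
      (afeX q (1 / 2 + v * I) * Complex.exp (((-(c * (v - t'))) : ℝ) * I) * (I *
        (-(2 * (LQ : ℂ)) - digamma (1 - (1 / 2 + v * I)) - digamma (1 / 2 + v * I) - c))) v := by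
    intro v
    have h1 : HasDerivAt (fun v : ℝ => -(c * (v - t'))) (-c) v :=
      ((((hasDerivAt_id' v).sub_const t').const_mul c).neg).congr_deriv (by ring)
    have h2 := (h1.ofReal_comp.mul_const I).cexp
    have h3 := (hasDerivAt_afeX_line hq0 v).mul h2
    refine h3.congr_deriv ?_
    push_cast
    ring
  have hA_bound : ∀ v ∈ Set.uIcc t' t,
      ‖afeX q (1 / 2 + v * I) * Complex.exp (((-(c * (v - t'))) : ℝ) * I) * (I *
        (-(2 * (LQ : ℂ)) - digamma (1 - (1 / 2 + v * I)) - digamma (1 / 2 + v * I) - c))‖ ≤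
        2 * (C₀ + 1) := by
    intro v hv
    have hvt : |v - t| < 1 := by
      have h := Set.abs_sub_right_of_mem_uIcc hv
      rw [abs_sub_comm] at h
      exact lt_of_le_of_lt h hfar
    have hv0 : 0 < v := by linarith [neg_abs_le (v - t)]
    rw [norm_mul, norm_mul, norm_mul, norm_afeX_half q hq0, Complex.norm_exp_ofReal_mul_I,
      Complex.norm_I, one_mul, one_mul, one_mul]
    have h1s : (1 : ℂ) - (1 / 2 + (v : ℂ) * I) = 1 / 2 + ((-v : ℝ) : ℂ) * I := by push_cast; ring
    have hdecomp : -(2 * (LQ : ℂ)) - digamma (1 - (1 / 2 + (v : ℂ) * I)) -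
        digamma (1 / 2 + (v : ℂ) * I) - (c : ℂ) =
        -((digamma (1 / 2 + ((-v : ℝ) : ℂ) * I) - Real.log t) +
          (digamma (1 / 2 + (v : ℂ) * I) - Real.log t)) := by
      rw [h1s, hcdef]; push_cast; ring
    rw [hdecomp, norm_neg]
    have hψ1 := norm_digamma_sub_log_le_of_near hC₀ ht hvt (-v) (by rw [abs_neg, abs_of_pos hv0])
    have hψ2 := norm_digamma_sub_log_le_of_near hC₀ ht hvt v (abs_of_pos hv0)
    exact (norm_add_le _ _).trans (by linarith)
  have hMV := Convex.norm_image_sub_le_of_norm_hasDerivWithin_le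
    (f := fun v : ℝ => afeX q (1 / 2 + v * I) * Complex.exp (((-(c * (v - t'))) : ℝ) * I))
    (fun v hv => (hZ v).hasDerivWithinAt) hA_bound (convex_uIcc t' t)
    Set.left_mem_uIcc Set.right_mem_uIcc
  -- `hMV : ‖f t − f t′‖ ≤ 2(C₀+1) ‖t − t′‖`
  simp only [sub_self, mul_zero, neg_zero, Complex.ofReal_zero, zero_mul, Complex.exp_zero,
    mul_one, Real.norm_eq_abs] at hMV
  -- `X(s) − X(s′) = (f t − X(s′)) E + X(s′)(E − 1)` with `E = e^{ic(t−t′)}`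
  set E : ℂ := Complex.exp (((c * (t - t')) : ℝ) * I) with hEdef
  have hEinv : Complex.exp (((-(c * (t - t'))) : ℝ) * I) * E = 1 := by
    rw [hEdef, ← Complex.exp_add]
    push_cast
    ring_nf
    exact Complex.exp_zero
  have hE1 : ‖E‖ = 1 := by rw [hEdef]; exact Complex.norm_exp_ofReal_mul_I _
  have hident : afeX q (1 / 2 + t * I) - afeX q (1 / 2 + t' * I) =
      (afeX q (1 / 2 + t * I) * Complex.exp (((-(c * (t - t'))) : ℝ) * I) - afeX q (1 / 2 + t' * I)) * E
        + afeX q (1 / 2 + t' * I) * (E - 1) := by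
    calc afeX q (1 / 2 + t * I) - afeX q (1 / 2 + t' * I)
        = afeX q (1 / 2 + t * I) * (Complex.exp (((-(c * (t - t'))) : ℝ) * I) * E) -
            afeX q (1 / 2 + t' * I) := by rw [hEinv, mul_one]
      _ = _ := by ring
  -- `‖E − 1‖ = 2|sin((t−t′)(log t + LQ))|`
  have hEsub : ‖E - 1‖ = 2 * |Real.sin ((t - t') * Real.log t + (t - t') * LQ)| := by
    rw [hEdef, show (((c * (t - t')) : ℝ) : ℂ) * I = I * (((c * (t - t')) : ℝ) : ℂ) by ring,
      Complex.norm_exp_I_mul_ofReal_sub_one, Real.norm_eq_abs, abs_mul, abs_two]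
    congr 1
    rw [hcdef, show -2 * (LQ + Real.log t) * (t - t') / 2 = -((t - t') * Real.log t + (t - t') * LQ)
      by ring, Real.sin_neg, abs_neg]
  -- `|sin((t−t′)log t + (t−t′)LQ)| ≥ |sin((t−t′)log t)| − |t−t′||LQ|`
  have hsin : |Real.sin ((t - t') * Real.log t)| - |t - t'| * |LQ| ≤
      |Real.sin ((t - t') * Real.log t + (t - t') * LQ)| := by
    have h := Real.abs_sin_sub_sin_le ((t - t') * Real.log t) ((t - t') * Real.log t + (t - t') * LQ)
    rw [show (t - t') * Real.log t - ((t - t') * Real.log t + (t - t') * LQ) = -((t - t') * LQ) by ring,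
      abs_neg, abs_mul] at h
    linarith [abs_sub_abs_le_abs_sub (Real.sin ((t - t') * Real.log t))
      (Real.sin ((t - t') * Real.log t + (t - t') * LQ))]
  -- lower bound for `‖X(s) − X(s′)‖`
  have hlow : 2 * |Real.sin ((t - t') * Real.log t)| - (2 * |LQ| + 2 * (C₀ + 1)) * |t - t'| ≤
      ‖afeX q (1 / 2 + t * I) - afeX q (1 / 2 + t' * I)‖ := by
    have h1 : ‖afeX q (1 / 2 + ↑t' * I) * (E - 1)‖ = 2 * |Real.sin ((t - t') * Real.log t + (t - t') * LQ)| := by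
      rw [norm_mul, norm_afeX_half q hq0, one_mul, hEsub]
    have h2 : ‖(afeX q (1 / 2 + t * I) * Complex.exp (((-(c * (t - t'))) : ℝ) * I) -
        afeX q (1 / 2 + t' * I)) * E‖ ≤ 2 * (C₀ + 1) * |t - t'| := by
      rw [norm_mul, hE1, mul_one]; exact hMV
    rw [hident]
    have h3 := norm_sub_norm_le (afeX q (1 / 2 + ↑t' * I) * (E - 1))
      (-((afeX q (1 / 2 + t * I) * Complex.exp (((-(c * (t - t'))) : ℝ) * I) -
        afeX q (1 / 2 + t' * I)) * E))
    rw [norm_neg, sub_neg_eq_add, add_comm (afeX q (1 / 2 + ↑t' * I) * (E - 1))] at h3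
    nlinarith [h1, h2, h3, hsin, habs0]
  -- the left side: `2 log t · |sinc| = 2|sin((t−t′)log t)|/|t−t′|`
  have hx : (t - t') * Real.log t ≠ 0 := mul_ne_zero hne hlogt.ne'
  have hLHS : 2 * Real.log t * sincTerm t t' = 2 * |Real.sin ((t - t') * Real.log t)| / |t - t'| := by
    unfold sincTerm
    rw [Real.sinc_of_ne_zero hx, abs_div, abs_mul, abs_of_pos hlogt]
    field_simp
  rw [hLHS, div_le_iff₀ habs0, add_mul, div_mul_cancel₀ _ habs0.ne']
  have hfar1 : |t - t'| ≤ 1 := hfar.le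
  nlinarith [hlow, hjunk, habs0, hfar1, abs_nonneg LQ, hxnn, hℓ1]

end ConreyIwaniec2002

end Literature.NumberTheory.LFunctions

end
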